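import Summits.CriticalPhenomena.PercolationContinuityZ3.Theorems.SahiAESeparableTilt
import Summits.CriticalPhenomena.PercolationContinuityZ3.Theorems.SahiAEVersionTransportAtoms
import Summits.CriticalPhenomena.PercolationContinuityZ3.Theorems.SahiAEPositivity

/-!
# Borel everywhere-MTP₂ versions under every product σ-finite reference measure (R5, general reference measure)

Support file of the Sahi cell (`prim-sahi`, typer seat, generation 21; `--supports stmt-CriticalPhenomena-4575`).
Theorems only (no definitions, no named facts, no sorries).

`SahiAESeparableTilt.exists_measurable_mtp2_version_of_ae_of_pos` (lit g35; R5 for LEBESGUE measure on `ℝ^ι`):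
a measurable `f : ℝ^ι → [c, M]`, `0 < c ≤ M < ∞`, MTP₂ on `λ ⊗ λ`-a.e. pair, has a bounded Borel version MTP₂ at
every pair.  `SahiAEVersionTransport.lean` / `SahiAEVersionTransportAtoms.lean` (typer g21) transport this property
to every finite product of σ-finite measures on `ℝ` (Karlin–Rinott's setting for MTP₂ densities: product reference
measures, e.g. Lebesgue or counting measure in each coordinate).  Here the two are combined:

* `hasBorelMTP2Versions_volume` — Lebesgue measure on `ℝ^ι` has the Borel-version property (restatement of R5);
* `hasBorelMTP2Versions_pi` — **so does `Measure.pi ρ` for EVERY finite family of σ-finite measures `ρᵢ` on `ℝ`**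
  (atoms allowed), and `hasBorelMTP2Versions_volume_restrict_pi` — Lebesgue measure restricted to any product set;
* `ae_prod_mem_inf_sup_of_sigmaFinite` (quasi-invariance of `π ⊗ π` under `∧`, `∨`), `ae_pair_mtp2_of_ae_eq`
  (the trivial converse), `ae_pair_mtp2_iff_exists_measurable_version` (the version theorem as an `↔`);
* `exists_measurable_mtp2_version_of_ae_pi` — the unfolded statement; `exists_measurable_mtp2_version_of_ae_pi'` —
  the same with the bounds `c ≤ f ≤ M` assumed only almost everywhere (the modification on a null set is harmless
  by quasi-invariance of `π ⊗ π` under `∧`, `∨`, `SahiCMTP2.ae_prod_inf_sup_mem`); `…_of_ae_volume'` — Lebesgue;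
* `exists_measurable_mtp2_density_of_isBoxTP2`, `isBoxTP2_withDensity_pi_iff_exists_mtp2_density` — an MTP₂ LAW
  (box-TP₂ measure `π·f`, `f ∈ [c, M]` integrable) has an everywhere-MTP₂ Borel density (Karlin–Rinott's pointwise
  sense), and conversely;
* `hasBorelMTP2Versions_withDensity_pi` / `_withDensity_volume` — every σ-finite reference measure with an
  a.e.-positive density with respect to a product measure (equivalent measures share the property);
* `hasBorelMTP2Versions_volume_unitCube`, `exists_measurable_mtp2_version_of_ae_unitCube` — Lebesgue measure on the
  closed unit cube `ι → [0,1]` (the cell's `Q_d`), by transport along `projIcc` / the inclusion.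

Scope: densities with zeros or not bounded away from `0` / `∞`, and non-product reference measures: NOT claimed
(open).  In infinite products no measurable version exists at all (`exists_aePair_latticeCondition_no_measurable_version`).
No sorries, no new axioms.
-/

noncomputable section

namespace Summit.CriticalPhenomena.PercolationContinuityZ3.Theorems.SahiAEFourFunctions

open MeasureTheory Set Filter Topology
open Summit.CriticalPhenomena.PercolationContinuityZ3.Theorems.SahiAESeparableTilt
open Summit.CriticalPhenomena.PercolationContinuityZ3.Theorems.SahiCMTP2
open Summit.CriticalPhenomena.PercolationContinuityZ3.Theorems.SahiBoxTP2 (IsBoxTP2)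
open scoped ENNReal NNReal unitInterval

variable {ι : Type*} [Fintype ι]

/-- **Lebesgue measure on `ℝ^ι` has the Borel-version property** (R5, `exists_measurable_mtp2_version_of_ae_of_pos`).
[this work] -/
theorem hasBorelMTP2Versions_volume : HasBorelMTP2Versions (volume : Measure (ι → ℝ)) :=
  fun f hf _ _ hc hM hcf hfM hMTP => exists_measurable_mtp2_version_of_ae_of_pos f hf hc hM hcf hfM hMTP

/-- **Every finite product of σ-finite measures on `ℝ` has the Borel-version property** (atoms allowed).
[this work] -/
theorem hasBorelMTP2Versions_pi (ρ : ι → Measure ℝ) [∀ i, SigmaFinite (ρ i)] : HasBorelMTP2Versions (Measure.pi ρ) :=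
  hasBorelMTP2Versions_volume.pi_of_volume' ρ

/-- Lebesgue measure restricted to any product set `∏ᵢ sᵢ ⊆ ℝ^ι` has the Borel-version property. [this work] -/
theorem hasBorelMTP2Versions_volume_restrict_pi (s : ι → Set ℝ) :
    HasBorelMTP2Versions ((volume : Measure (ι → ℝ)).restrict (Set.pi univ s)) :=
  hasBorelMTP2Versions_volume.restrict_pi_of_volume s

/-- Quasi-invariance of `π ⊗ π` under meet and join for a finite product `π` of σ-finite measures on `ℝ`: almost
every pair has its two members, its meet and its join in any set of full `π`-measure (the finite case is
`SahiCMTP2.ae_prod_inf_sup_mem`; σ-finite factors via the equivalent finite measures `(ρ i).toFinite`). [folklore] -/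
theorem ae_prod_mem_inf_sup_of_sigmaFinite (ρ : ι → Measure ℝ) [∀ i, SigmaFinite (ρ i)] {G : Set (ι → ℝ)}
    (hG : ∀ᵐ u ∂Measure.pi ρ, u ∈ G) :
    ∀ᵐ p ∂(Measure.pi ρ).prod (Measure.pi ρ), (p.1 ∈ G ∧ p.2 ∈ G) ∧ p.1 ⊓ p.2 ∈ G ∧ p.1 ⊔ p.2 ∈ G := by
  set π := Measure.pi ρ with hπ
  set ν : ι → Measure ℝ := fun i => (ρ i).toFinite with hν
  have h1 : Measure.pi ν ≪ π := pi_toFinite_absolutelyContinuous_pi ρ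
  have h2 : π ≪ Measure.pi ν := pi_absolutelyContinuous_pi_toFinite ρ
  have h4 : ∀ᵐ p ∂π.prod π, p.1 ⊓ p.2 ∈ G ∧ p.1 ⊔ p.2 ∈ G :=
    (h2.prod h2).ae_le (ae_prod_inf_sup_mem ν (h1.ae_le hG))
  have h5 : ∀ᵐ p ∂π.prod π, p.1 ∈ G ∧ p.2 ∈ G := by
    filter_upwards [(Measure.quasiMeasurePreserving_fst (μ := π) (ν := π)).ae hG,
      (Measure.quasiMeasurePreserving_snd (μ := π) (ν := π)).ae hG] with p hp1 hp2 using ⟨hp1, hp2⟩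
  exact h5.and h4

/-- **Converse (trivial direction): a function almost everywhere equal to an everywhere-MTP₂ function is MTP₂ on
almost every pair** (product reference measure; quasi-invariance). [this work] -/
theorem ae_pair_mtp2_of_ae_eq (ρ : ι → Measure ℝ) [∀ i, SigmaFinite (ρ i)] {f F : (ι → ℝ) → ℝ≥0∞}
    (hFf : F =ᵐ[Measure.pi ρ] f) (hF : ∀ x y, F x * F y ≤ F (x ⊓ y) * F (x ⊔ y)) :
    ∀ᵐ p ∂(Measure.pi ρ).prod (Measure.pi ρ), f p.1 * f p.2 ≤ f (p.1 ⊓ p.2) * f (p.1 ⊔ p.2) := by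
  filter_upwards [ae_prod_mem_inf_sup_of_sigmaFinite ρ (G := {x | F x = f x}) hFf] with p hp
  rw [← show F p.1 = f p.1 from hp.1.1, ← show F p.2 = f p.2 from hp.1.2, ← show F (p.1 ⊓ p.2) = f (p.1 ⊓ p.2) from hp.2.1,
    ← show F (p.1 ⊔ p.2) = f (p.1 ⊔ p.2) from hp.2.2]
  exact hF p.1 p.2

/-- **Borel everywhere-MTP₂ versions under a product reference measure (unfolded).**  Let `ρᵢ` (`i ∈ ι`, finite) be
σ-finite measures on `ℝ`, `π = ⊗ᵢ ρᵢ`, and `f : ℝ^ι → [c, M]` measurable (`0 < c`, `M < ∞`) with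
`f(x) f(y) ≤ f(x ∧ y) f(x ∨ y)` for `π ⊗ π`-almost every `(x, y)`.  Then there is a bounded Borel measurable `F` with
`F = f` `π`-a.e. and `F(x) F(y) ≤ F(x ∧ y) F(x ∨ y)` for ALL `x, y`. [this work] -/
theorem exists_measurable_mtp2_version_of_ae_pi (ρ : ι → Measure ℝ) [∀ i, SigmaFinite (ρ i)]
    (f : (ι → ℝ) → ℝ≥0∞) (hf : Measurable f) {c M : ℝ≥0∞} (hc : c ≠ 0) (hM : M ≠ ∞)
    (hcf : ∀ x, c ≤ f x) (hfM : ∀ x, f x ≤ M)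
    (hMTP : ∀ᵐ p ∂(Measure.pi ρ).prod (Measure.pi ρ), f p.1 * f p.2 ≤ f (p.1 ⊓ p.2) * f (p.1 ⊔ p.2)) :
    ∃ F : (ι → ℝ) → ℝ≥0∞, Measurable F ∧ (∃ M' : ℝ≥0∞, M' ≠ ∞ ∧ ∀ x, F x ≤ M') ∧ F =ᵐ[Measure.pi ρ] f ∧
      ∀ x y, F x * F y ≤ F (x ⊓ y) * F (x ⊔ y) :=
  hasBorelMTP2Versions_pi ρ f hf c M hc hM hcf hfM hMTP

/-- **The same with almost-everywhere bounds.**  If `c ≤ f ≤ M` holds only `π`-almost everywhere, modify `f` on the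
exceptional null set first; the a.e.-MTP₂ hypothesis survives because `π ⊗ π`-almost every pair has its two members,
its meet and its join outside any `π`-null set (quasi-invariance, `SahiCMTP2.ae_prod_inf_sup_mem`, applied to the
equivalent finite measures `(ρ i).toFinite`). [this work] -/
theorem exists_measurable_mtp2_version_of_ae_pi' (ρ : ι → Measure ℝ) [∀ i, SigmaFinite (ρ i)]
    (f : (ι → ℝ) → ℝ≥0∞) (hf : Measurable f) {c M : ℝ≥0∞} (hc : c ≠ 0) (hM : M ≠ ∞)
    (hbd : ∀ᵐ x ∂Measure.pi ρ, c ≤ f x ∧ f x ≤ M)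
    (hMTP : ∀ᵐ p ∂(Measure.pi ρ).prod (Measure.pi ρ), f p.1 * f p.2 ≤ f (p.1 ⊓ p.2) * f (p.1 ⊔ p.2)) :
    ∃ F : (ι → ℝ) → ℝ≥0∞, Measurable F ∧ (∃ M' : ℝ≥0∞, M' ≠ ∞ ∧ ∀ x, F x ≤ M') ∧ F =ᵐ[Measure.pi ρ] f ∧
      ∀ x y, F x * F y ≤ F (x ⊓ y) * F (x ⊔ y) := by
  set π := Measure.pi ρ with hπ
  by_cases hcM : c ≤ M
  swap
  · -- then the bounds force `π = 0`, and the constant `M` is a version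
    have h0 : ∀ᵐ x ∂π, False := by
      filter_upwards [hbd] with x hx using hcM (hx.1.trans hx.2)
    have hπ0 : π = 0 := ae_eq_bot.1 (Filter.eventually_false_iff_eq_bot.1 h0)
    refine ⟨fun _ => M, measurable_const, ⟨M, hM, fun _ => le_rfl⟩, ?_, fun _ _ => le_rfl⟩
    rw [hπ0]; exact ae_zero.le (by simp)
  -- the modified density
  set G : Set (ι → ℝ) := {x | c ≤ f x ∧ f x ≤ M} with hG
  have mG : MeasurableSet G := (measurableSet_le measurable_const hf).inter (measurableSet_le hf measurable_const)
  set g : (ι → ℝ) → ℝ≥0∞ := G.piecewise f (fun _ => c) with hg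
  have hgm : Measurable g := hf.piecewise mG measurable_const
  have hg_of_mem : ∀ x ∈ G, g x = f x := fun x hx => Set.piecewise_eq_of_mem _ _ _ hx
  have hg_of_not_mem : ∀ x ∉ G, g x = c := fun x hx => Set.piecewise_eq_of_notMem _ _ _ hx
  have hcg : ∀ x, c ≤ g x := fun x => by
    by_cases hx : x ∈ G
    · rw [hg_of_mem x hx]; exact hx.1
    · rw [hg_of_not_mem x hx]
  have hgM : ∀ x, g x ≤ M := fun x => by
    by_cases hx : x ∈ G
    · rw [hg_of_mem x hx]; exact hx.2
    · rw [hg_of_not_mem x hx]; exact hcM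
  have hgf : g =ᵐ[π] f := by
    filter_upwards [hbd] with x hx using hg_of_mem x hx
  -- quasi-invariance: almost every pair has both members, the meet and the join in `G`
  have hgMTP : ∀ᵐ p ∂π.prod π, g p.1 * g p.2 ≤ g (p.1 ⊓ p.2) * g (p.1 ⊔ p.2) := by
    filter_upwards [hMTP, ae_prod_mem_inf_sup_of_sigmaFinite ρ (G := G) hbd] with p hp hG4
    rw [hg_of_mem _ hG4.1.1, hg_of_mem _ hG4.1.2, hg_of_mem _ hG4.2.1, hg_of_mem _ hG4.2.2]
    exact hp
  obtain ⟨F, hFm, hFb, hFg, hFmtp⟩ := hasBorelMTP2Versions_pi ρ g hgm c M hc hM hcg hgM hgMTP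
  exact ⟨F, hFm, hFb, hFg.trans hgf, hFmtp⟩

/-- **The version theorem as an equivalence.**  For a measurable `f : ℝ^ι → [c, M]` (`0 < c`, `M < ∞`) and a finite
product `π` of σ-finite measures on `ℝ`: `f` is MTP₂ on `π ⊗ π`-almost every pair if and only if it has a bounded
Borel version which is MTP₂ at every pair. [this work] -/
theorem ae_pair_mtp2_iff_exists_measurable_version (ρ : ι → Measure ℝ) [∀ i, SigmaFinite (ρ i)]
    (f : (ι → ℝ) → ℝ≥0∞) (hf : Measurable f) {c M : ℝ≥0∞} (hc : c ≠ 0) (hM : M ≠ ∞)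
    (hcf : ∀ x, c ≤ f x) (hfM : ∀ x, f x ≤ M) :
    (∀ᵐ p ∂(Measure.pi ρ).prod (Measure.pi ρ), f p.1 * f p.2 ≤ f (p.1 ⊓ p.2) * f (p.1 ⊔ p.2)) ↔
      ∃ F : (ι → ℝ) → ℝ≥0∞, Measurable F ∧ (∃ M' : ℝ≥0∞, M' ≠ ∞ ∧ ∀ x, F x ≤ M') ∧ F =ᵐ[Measure.pi ρ] f ∧
        ∀ x y, F x * F y ≤ F (x ⊓ y) * F (x ⊔ y) :=
  ⟨exists_measurable_mtp2_version_of_ae_pi ρ f hf hc hM hcf hfM, fun ⟨_, _, _, hFf, hF⟩ => ae_pair_mtp2_of_ae_eq ρ hFf hF⟩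

/-- **Lebesgue reference measure, almost-everywhere bounds.** [this work] -/
theorem exists_measurable_mtp2_version_of_ae_volume' (f : (ι → ℝ) → ℝ≥0∞) (hf : Measurable f) {c M : ℝ≥0∞}
    (hc : c ≠ 0) (hM : M ≠ ∞) (hbd : ∀ᵐ x ∂(volume : Measure (ι → ℝ)), c ≤ f x ∧ f x ≤ M)
    (hMTP : ∀ᵐ p ∂(volume : Measure (ι → ℝ)).prod volume, f p.1 * f p.2 ≤ f (p.1 ⊓ p.2) * f (p.1 ⊔ p.2)) :
    ∃ F : (ι → ℝ) → ℝ≥0∞, Measurable F ∧ (∃ M' : ℝ≥0∞, M' ≠ ∞ ∧ ∀ x, F x ≤ M') ∧ F =ᵐ[volume] f ∧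
      ∀ x y, F x * F y ≤ F (x ⊓ y) * F (x ⊔ y) := by
  have h := exists_measurable_mtp2_version_of_ae_pi' (fun _ : ι => (volume : Measure ℝ)) f hf hc hM
    (by rw [← volume_pi]; exact hbd) (by rw [← volume_pi]; exact hMTP)
  rwa [← volume_pi] at h

/-! ### MTP₂ laws (box-TP₂ measures) have everywhere-MTP₂ Borel densities -/

/-- **An MTP₂ law with a density bounded away from `0` and `∞` has an everywhere-MTP₂ Borel density.**  For
`π = ⊗ᵢ ρᵢ` (locally finite `ρᵢ` on `ℝ`) and a measurable integrable `f : ℝ^ι → [c, M]` (`0 < c`, `M < ∞`): if the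
law `π·f` is box-TP₂ (the measure-level FKG lattice condition on closed boxes, `IsBoxTP2`; ⟺ set-TP₂ ⟺ affiliated),
then `π·f = π·F` for a bounded Borel `F` with `F(x) F(y) ≤ F(x ∧ y) F(x ∨ y)` at EVERY pair — i.e. the density can
be chosen MTP₂ in Karlin–Rinott's pointwise sense.  (`isBoxTP2_withDensity_pi_iff_ae` + the version theorem.)
[this work] -/
theorem exists_measurable_mtp2_density_of_isBoxTP2 (ρ : ι → Measure ℝ) [∀ i, IsLocallyFiniteMeasure (ρ i)]
    (f : (ι → ℝ) → ℝ≥0∞) (hf : Measurable f) (hfin : ∫⁻ z, f z ∂Measure.pi ρ ≠ ∞) {c M : ℝ≥0∞} (hc : c ≠ 0)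
    (hM : M ≠ ∞) (hcf : ∀ x, c ≤ f x) (hfM : ∀ x, f x ≤ M) (h : IsBoxTP2 ((Measure.pi ρ).withDensity f)) :
    ∃ F : (ι → ℝ) → ℝ≥0∞, Measurable F ∧ (∃ M' : ℝ≥0∞, M' ≠ ∞ ∧ ∀ x, F x ≤ M') ∧
      (Measure.pi ρ).withDensity F = (Measure.pi ρ).withDensity f ∧ ∀ x y, F x * F y ≤ F (x ⊓ y) * F (x ⊔ y) := by
  obtain ⟨F, hFm, hFb, hFf, hFmtp⟩ := exists_measurable_mtp2_version_of_ae_pi ρ f hf hc hM hcf hfM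
    ((isBoxTP2_withDensity_pi_iff_ae ρ f hf hfin).1 h)
  exact ⟨F, hFm, hFb, withDensity_congr_ae hFf, hFmtp⟩

/-- **Box-TP₂ ⟺ existence of an everywhere-MTP₂ Borel density** (densities bounded away from `0` and `∞`,
product reference measure with locally finite factors). [this work] -/
theorem isBoxTP2_withDensity_pi_iff_exists_mtp2_density (ρ : ι → Measure ℝ) [∀ i, IsLocallyFiniteMeasure (ρ i)]
    (f : (ι → ℝ) → ℝ≥0∞) (hf : Measurable f) (hfin : ∫⁻ z, f z ∂Measure.pi ρ ≠ ∞) {c M : ℝ≥0∞} (hc : c ≠ 0)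
    (hM : M ≠ ∞) (hcf : ∀ x, c ≤ f x) (hfM : ∀ x, f x ≤ M) :
    IsBoxTP2 ((Measure.pi ρ).withDensity f) ↔
      ∃ F : (ι → ℝ) → ℝ≥0∞, Measurable F ∧ (∃ M' : ℝ≥0∞, M' ≠ ∞ ∧ ∀ x, F x ≤ M') ∧
        (Measure.pi ρ).withDensity F = (Measure.pi ρ).withDensity f ∧ ∀ x y, F x * F y ≤ F (x ⊓ y) * F (x ⊔ y) := by
  refine ⟨exists_measurable_mtp2_density_of_isBoxTP2 ρ f hf hfin hc hM hcf hfM, fun ⟨F, hFm, _, hFeq, hFmtp⟩ => ?_⟩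
  rw [← hFeq]
  exact isBoxTP2_withDensity_pi_of_ae ρ F hFm (Eventually.of_forall fun p => hFmtp p.1 p.2)

/-! ### Reference measures with a positive density with respect to a product measure -/

/-- **Every σ-finite reference measure with an a.e.-positive density with respect to a product measure** (e.g. a
correlated Gaussian law, a Gibbs measure with positive Boltzmann weight) has the Borel-version property: it is
equivalent to the product measure, and the property is invariant under equivalence. [this work] -/
theorem hasBorelMTP2Versions_withDensity_pi (ρ : ι → Measure ℝ) [∀ i, SigmaFinite (ρ i)] {h : (ι → ℝ) → ℝ≥0∞}
    (hh : Measurable h) (h0 : ∀ᵐ x ∂Measure.pi ρ, h x ≠ 0) :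
    HasBorelMTP2Versions ((Measure.pi ρ).withDensity h) :=
  (hasBorelMTP2Versions_pi ρ).of_equivalent (withDensity_absolutelyContinuous _ _)
    (withDensity_absolutelyContinuous' hh.aemeasurable h0)

/-- In particular for Lebesgue measure: `HasBorelMTP2Versions (volume.withDensity h)` for every measurable
a.e.-positive `h`. [this work] -/
theorem hasBorelMTP2Versions_withDensity_volume {h : (ι → ℝ) → ℝ≥0∞} (hh : Measurable h)
    (h0 : ∀ᵐ x ∂(volume : Measure (ι → ℝ)), h x ≠ 0) :
    HasBorelMTP2Versions ((volume : Measure (ι → ℝ)).withDensity h) :=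
  hasBorelMTP2Versions_volume.of_equivalent (withDensity_absolutelyContinuous _ _)
    (withDensity_absolutelyContinuous' hh.aemeasurable h0)

/-! ### The closed unit cube `ι → [0,1]` (the cell's `Q_d`) -/

/-- **Lebesgue measure on the closed unit cube `ι → [0,1]` has the Borel-version property**: transport from
`λ|_{[0,1]^ι} ⊂ ℝ^ι` along the coordinatewise projection `projIcc` (a lattice homomorphism `ℝ^ι → [0,1]^ι`) and
the inclusion (measure preserving, `unitInterval.measurePreserving_coe`). [this work] -/
theorem hasBorelMTP2Versions_volume_unitCube : HasBorelMTP2Versions (volume : Measure (ι → I)) := by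
  set μ : Measure (ι → ℝ) := (volume : Measure (ι → ℝ)).restrict (Set.pi univ fun _ => Icc (0 : ℝ) 1) with hμ
  have hP : HasBorelMTP2Versions μ := hasBorelMTP2Versions_volume_restrict_pi fun _ => Icc (0 : ℝ) 1
  set T : (ι → ℝ) → (ι → I) := fun x i => projIcc (0 : ℝ) 1 zero_le_one (x i) with hT
  set R : (ι → I) → (ι → ℝ) := fun y i => (y i : ℝ) with hR
  have hTm : Measurable T :=
    measurable_pi_iff.2 fun i => continuous_projIcc.measurable.comp (measurable_pi_apply i)
  have hRmp : MeasurePreserving R (volume : Measure (ι → I)) μ := by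
    rw [hμ, volume_pi, volume_pi, Measure.restrict_pi_pi]
    exact measurePreserving_pi _ _ fun _ => unitInterval.measurePreserving_coe
  have hTR : T ∘ R = id := funext fun y => funext fun i => projIcc_val zero_le_one (y i)
  have hmap : μ.map T = (volume : Measure (ι → I)) := by
    rw [← hRmp.map_eq, Measure.map_map hTm hRmp.measurable, hTR, Measure.map_id]
  have hTlat : ∀ x y : ι → ℝ, T (x ⊓ y) = T x ⊓ T y ∧ T (x ⊔ y) = T x ⊔ T y := by
    intro x y
    refine ⟨funext fun i => ?_, funext fun i => ?_⟩
    · show projIcc (0 : ℝ) 1 zero_le_one (x i ⊓ y i) =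
        projIcc (0 : ℝ) 1 zero_le_one (x i) ⊓ projIcc (0 : ℝ) 1 zero_le_one (y i)
      refine le_antisymm (le_inf (monotone_projIcc _ inf_le_left) (monotone_projIcc _ inf_le_right)) ?_
      rcases le_total (x i) (y i) with h | h
      · rw [inf_eq_left.2 h]; exact inf_le_left
      · rw [inf_eq_right.2 h]; exact inf_le_right
    · show projIcc (0 : ℝ) 1 zero_le_one (x i ⊔ y i) =
        projIcc (0 : ℝ) 1 zero_le_one (x i) ⊔ projIcc (0 : ℝ) 1 zero_le_one (y i)
      refine le_antisymm ?_ (sup_le (monotone_projIcc _ le_sup_left) (monotone_projIcc _ le_sup_right))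
      rcases le_total (x i) (y i) with h | h
      · rw [sup_eq_right.2 h]; exact le_sup_right
      · rw [sup_eq_left.2 h]; exact le_sup_left
  have hRlat : ∀ x ∈ (univ : Set (ι → I)), ∀ y ∈ (univ : Set (ι → I)),
      R (x ⊓ y) = R x ⊓ R y ∧ R (x ⊔ y) = R x ⊔ R y := by
    intro x _ y _
    refine ⟨funext fun i => ?_, funext fun i => ?_⟩
    · show ((x i ⊓ y i : I) : ℝ) = (x i : ℝ) ⊓ (y i : ℝ)
      refine le_antisymm (le_inf (Subtype.coe_le_coe.2 inf_le_left) (Subtype.coe_le_coe.2 inf_le_right)) ?_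
      rcases le_total (x i) (y i) with h | h
      · exact inf_le_left.trans (Subtype.coe_le_coe.2 (le_inf le_rfl h))
      · exact inf_le_right.trans (Subtype.coe_le_coe.2 (le_inf h le_rfl))
    · show ((x i ⊔ y i : I) : ℝ) = (x i : ℝ) ⊔ (y i : ℝ)
      refine le_antisymm ?_ (sup_le (Subtype.coe_le_coe.2 le_sup_left) (Subtype.coe_le_coe.2 le_sup_right))
      rcases le_total (x i) (y i) with h | h
      · exact (Subtype.coe_le_coe.2 (sup_le h le_rfl)).trans le_sup_right
      · exact (Subtype.coe_le_coe.2 (sup_le le_rfl h)).trans le_sup_left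
  have hRT : ∀ᵐ x ∂μ, R (T x) = x := by
    filter_upwards [ae_restrict_mem (MeasurableSet.univ_pi fun _ => measurableSet_Icc)] with x hx
    exact funext fun i => congrArg Subtype.val (Set.projIcc_of_mem zero_le_one (Set.mem_univ_pi.1 hx i))
  exact hP.transport hTm hRmp.measurable (Eventually.of_forall fun p => hTlat p.1 p.2) (by rw [hmap]) (by rw [hmap])
    MeasurableSet.univ (by simp) (fun _ _ _ _ => mem_univ _) (fun _ _ _ _ => mem_univ _) hRlat hRT

/-- **Unfolded, on the unit cube `Q_ι = [0,1]^ι` with Lebesgue measure**: every measurable `f : Q_ι → [c, M]`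
(`0 < c`, `M < ∞`) which is MTP₂ on almost every pair has a bounded Borel version `F = f` a.e. with
`F(x) F(y) ≤ F(x ∧ y) F(x ∨ y)` for ALL `x, y`. [this work] -/
theorem exists_measurable_mtp2_version_of_ae_unitCube (f : (ι → I) → ℝ≥0∞) (hf : Measurable f) {c M : ℝ≥0∞}
    (hc : c ≠ 0) (hM : M ≠ ∞) (hcf : ∀ x, c ≤ f x) (hfM : ∀ x, f x ≤ M)
    (hMTP : ∀ᵐ p ∂(volume : Measure (ι → I)).prod volume, f p.1 * f p.2 ≤ f (p.1 ⊓ p.2) * f (p.1 ⊔ p.2)) :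
    ∃ F : (ι → I) → ℝ≥0∞, Measurable F ∧ (∃ M' : ℝ≥0∞, M' ≠ ∞ ∧ ∀ x, F x ≤ M') ∧ F =ᵐ[volume] f ∧
      ∀ x y, F x * F y ≤ F (x ⊓ y) * F (x ⊔ y) :=
  hasBorelMTP2Versions_volume_unitCube f hf c M hc hM hcf hfM hMTP

end Summit.CriticalPhenomena.PercolationContinuityZ3.Theorems.SahiAEFourFunctions
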